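import Literature.NumberTheory.Sieve.CFSemigroupRenewalTheorem
import HarnessLib

/-!
# The Tauberian step of the renewal theorem, abstract form

Support file (all results proved) for the named fact
`Literature.NumberTheory.Sieve.MageeOhWinter2019_uniformCounting` (`CFSemigroupCounting.lean`).
`CFSemigroupRenewalTheorem.lean` proves `N(X, x; G) ~ ν(G) c(x) X^{2δ}` for a fixed test function.
The comparison of the lattice-point count with the dynamical count ([MageeOhWinter2019, §3,
Lemmas 12–14]) leads to counting functions whose Laplace transforms are of the more general form
`α s^{-1} ((1 - L_{δs})^{-1} G_s)(x) + E(s)` with a test function `G_s` depending holomorphically on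
`s` (a threshold modified by a cocycle) and an extra term `E` holomorphic across `Re s = 1` (e.g.
from the restriction to words of even length, `(1 - L²)^{-1} = ½ (1 - L)^{-1} + ½ (1 + L)^{-1}`).
This file isolates the Tauberian step in that generality:

* `tendsto_of_cfLaplace`: let `a : ℝ → ℝ` be non-decreasing, non-negative, `a(u) ≤ K (1 + e^u)`;
  let `s ↦ G_s ∈ CfLip` be continuous on `Re s ≥ 1` with `s ↦ ν(G_s)` differentiable at `1` and
  `ν(G_1) = ν₁ ∈ ℝ`; let `E` be continuous on `Re s ≥ 1`; if
  `∫_0^∞ a(u) e^{-su} du = α s^{-1} ((1 - L_{δs})^{-1} G_s)(x) + E(s)` for `Re s > 1`, then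
  `e^{-u} a(u) → α ν₁ h(x) / (δ κ)`. [cite: MageeOhWinter2019, Prop. 17]
* `tendsto_rpow_of_tendsto_exp`: translation to `N(X) X^{-2δ} → c` when `a(u) = N(e^{u/(2δ)})`.

## References

* M. Magee, H. Oh, D. Winter, J. reine angew. Math. 753 (2019) 89–135, §3.1, Prop. 17.
  [MageeOhWinter2019]
* H. L. Montgomery, R. C. Vaughan, Multiplicative Number Theory I, CUP 2007, Thm. 8.6.
  [MontgomeryVaughan2007]
-/

noncomputable section

open Set Filter Metric MeasureTheory
open scoped Topology

namespace Literature.NumberTheory.Sieve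

variable {A : Finset ℕ}

/-! ### The density `B(u) = 1{u > 0} e^{-u} a(u)` of a general counting function -/

section Density

variable (a : ℝ → ℝ)

/-- `B(u) = 1{u > 0} e^{-u} a(u)`. [folklore] -/
def cfDens (u : ℝ) : ℝ := (Set.Ioi (0 : ℝ)).indicator (fun u => Real.exp (-u) * a u) u

/-- `B = 0` on `u ≤ 0`. [folklore] -/
theorem cfDens_of_nonpos {u : ℝ} (hu : u ≤ 0) : cfDens a u = 0 :=
  Set.indicator_of_notMem (fun h : u ∈ Set.Ioi (0 : ℝ) => not_lt.2 hu h) _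

/-- `B` on `u > 0`. [folklore] -/
theorem cfDens_of_pos {u : ℝ} (hu : 0 < u) : cfDens a u = Real.exp (-u) * a u :=
  Set.indicator_of_mem (show u ∈ Set.Ioi (0 : ℝ) from hu) _

variable {a}

/-- `B ≥ 0`. [folklore] -/
theorem cfDens_nonneg (ha0 : ∀ u, 0 ≤ a u) (u : ℝ) : 0 ≤ cfDens a u := by
  rcases le_or_gt u 0 with hu | hu
  · rw [cfDens_of_nonpos a hu]
  · rw [cfDens_of_pos a hu]; exact mul_nonneg (Real.exp_pos _).le (ha0 u)

/-- `B` is measurable (`a` non-decreasing). [folklore] -/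
theorem measurable_cfDens (hmono : Monotone a) : Measurable (cfDens a) :=
  ((Real.continuous_exp.comp continuous_neg).measurable.mul hmono.measurable).indicator measurableSet_Ioi

/-- `B` is slowly decreasing. [folklore] -/
theorem cfDens_mono (hmono : Monotone a) (ha0 : ∀ u, 0 ≤ a u) (u v : ℝ) (huv : u ≤ v) :
    cfDens a u * Real.exp (u - v) ≤ cfDens a v := by
  rcases le_or_gt u 0 with hu | hu
  · rw [cfDens_of_nonpos a hu, zero_mul]; exact cfDens_nonneg ha0 v
  · have hv : 0 < v := lt_of_lt_of_le hu huv
    rw [cfDens_of_pos a hu, cfDens_of_pos a hv]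
    have hexp : Real.exp (-u) * Real.exp (u - v) = Real.exp (-v) := by
      rw [← Real.exp_add]; congr 1; ring
    have e : Real.exp (-u) * a u * Real.exp (u - v) = Real.exp (-v) * a u := by rw [← hexp]; ring
    rw [e]
    exact mul_le_mul_of_nonneg_left (hmono huv) (Real.exp_pos _).le

/-- `B ≤ 2K` if `a(u) ≤ K(1 + e^u)`. [folklore] -/
theorem cfDens_le {K : ℝ} (hK0 : 0 ≤ K) (hK : ∀ u, a u ≤ K * (1 + Real.exp u)) (u : ℝ) : cfDens a u ≤ 2 * K := by
  rcases le_or_gt u 0 with hu | hu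
  · rw [cfDens_of_nonpos a hu]; positivity
  · rw [cfDens_of_pos a hu]
    have he : Real.exp (-u) * Real.exp u = 1 := by rw [← Real.exp_add]; simp
    have he1 : Real.exp (-u) ≤ 1 := Real.exp_le_one_iff.2 (by linarith)
    calc Real.exp (-u) * a u ≤ Real.exp (-u) * (K * (1 + Real.exp u)) :=
          mul_le_mul_of_nonneg_left (hK u) (Real.exp_pos _).le
      _ = K * Real.exp (-u) + K * (Real.exp (-u) * Real.exp u) := by ring
      _ ≤ K * 1 + K * 1 := by rw [he]; nlinarith
      _ = 2 * K := by ring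

/-- `B e^{-εu}` is integrable on `(0, ∞)`. [folklore] -/
theorem integrableOn_cfDens (hmono : Monotone a) (ha0 : ∀ u, 0 ≤ a u) {K : ℝ} (hK0 : 0 ≤ K)
    (hK : ∀ u, a u ≤ K * (1 + Real.exp u)) {ε : ℝ} (hε : 0 < ε) :
    IntegrableOn (fun u => cfDens a u * Real.exp (-(ε * u))) (Set.Ioi 0) := by
  have hg : IntegrableOn (fun u : ℝ => 2 * K * Real.exp (-ε * u)) (Set.Ioi 0) :=
    (exp_neg_integrableOn_Ioi 0 hε).const_mul (2 * K)
  refine Integrable.mono' hg ?_ (Eventually.of_forall fun u => ?_)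
  · exact ((measurable_cfDens hmono).mul
      (Real.continuous_exp.comp (continuous_const.mul continuous_id).neg).measurable).aestronglyMeasurable
  · rw [Real.norm_eq_abs, abs_of_nonneg (mul_nonneg (cfDens_nonneg ha0 u) (Real.exp_pos _).le), neg_mul]
    exact mul_le_mul_of_nonneg_right (cfDens_le hK0 hK u) (Real.exp_pos _).le

/-- The complex Laplace integrand of `B` is integrable for `Re s > 1`. [folklore] -/
theorem integrableOn_cfDens_cexp (hmono : Monotone a) (ha0 : ∀ u, 0 ≤ a u) {K : ℝ} (hK0 : 0 ≤ K)
    (hK : ∀ u, a u ≤ K * (1 + Real.exp u)) {s : ℂ} (hs : 1 < s.re) :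
    IntegrableOn (fun u : ℝ => ((cfDens a u : ℝ) : ℂ) * Complex.exp (-(s - 1) * u)) (Set.Ioi 0) := by
  have hg := integrableOn_cfDens hmono ha0 hK0 hK (by linarith : 0 < s.re - 1)
  refine Integrable.mono' hg ?_ (Eventually.of_forall fun u => ?_)
  · exact ((Complex.continuous_ofReal.measurable.comp (measurable_cfDens hmono)).mul
      (Complex.continuous_exp.comp (continuous_const.mul
        (Complex.continuous_ofReal.comp continuous_id))).measurable).aestronglyMeasurable
  · have hre : (-(s - 1) * (u : ℂ)).re = -((s.re - 1) * u) := by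
      simp only [neg_mul, Complex.neg_re, Complex.mul_re, Complex.sub_re, Complex.one_re, Complex.ofReal_re,
        Complex.sub_im, Complex.one_im, Complex.ofReal_im, mul_zero, sub_zero]
    rw [norm_mul, Complex.norm_real, Real.norm_of_nonneg (cfDens_nonneg ha0 u), Complex.norm_exp, hre]

/-- On `u > 0`: `B(u) e^{-(s-1)u} = a(u) e^{-su}`. [folklore] -/
theorem cfDens_mul_cexp {u : ℝ} (hu : 0 < u) (s : ℂ) :
    ((cfDens a u : ℝ) : ℂ) * Complex.exp (-(s - 1) * u) = (a u : ℂ) * Complex.exp (-s * u) := by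
  rw [cfDens_of_pos a hu, Complex.ofReal_mul, Complex.ofReal_exp, mul_comm (Complex.exp _) (a u : ℂ),
    mul_assoc, ← Complex.exp_add]
  congr 2
  push_cast
  ring

/-- The Laplace integrand of `a` is integrable for `Re s > 1`. [folklore] -/
theorem integrableOn_a_cexp (hmono : Monotone a) (ha0 : ∀ u, 0 ≤ a u) {K : ℝ} (hK0 : 0 ≤ K)
    (hK : ∀ u, a u ≤ K * (1 + Real.exp u)) {s : ℂ} (hs : 1 < s.re) :
    IntegrableOn (fun u : ℝ => (a u : ℂ) * Complex.exp (-s * u)) (Set.Ioi 0) :=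
  (integrableOn_cfDens_cexp hmono ha0 hK0 hK hs).congr_fun (fun _ hu => cfDens_mul_cexp hu s) measurableSet_Ioi

end Density

/-! ### The abstract Tauberian step -/

section Tauber

variable (A) (hA : ∀ a ∈ A, 1 ≤ a) (h2 : 2 ≤ A.card)
include hA h2

/-- **The Tauberian step of the renewal theorem, abstract form.** Let `a` be non-decreasing,
non-negative with `a(u) ≤ K(1 + e^u)`; let `s ↦ G_s ∈ CfLip` be continuous on `Re s ≥ 1` with
`s ↦ ν(G_s)` differentiable at `s = 1` and `ν(G_1) = ν₁` real; let `E` be continuous on `Re s ≥ 1`.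
If `∫_0^∞ a(u) e^{-su} du = α s^{-1} F_{G_s,x}(δ s) + E(s)` for `Re s > 1`, then
`e^{-u} a(u) → α ν₁ h(x)/(δ κ)`, `κ = ∫ 2 h log(1/·) dν`. (Wiener–Ikehara in Laplace form; the pole of
`F` at `δ` has residue `ν(G) h(x)/κ`, `CFSemigroupLaplace.lean`.) [cite: MageeOhWinter2019, Prop. 17] -/
theorem tendsto_of_cfLaplace {a : ℝ → ℝ} (hmono : Monotone a) (ha0 : ∀ u, 0 ≤ a u) {K : ℝ} (hK0 : 0 ≤ K)
    (hK : ∀ u, a u ≤ K * (1 + Real.exp u)) {Gfam : ℂ → CfLip}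
    (hGcont : ContinuousOn Gfam {s : ℂ | 1 ≤ s.re})
    (hGdiff : DifferentiableAt ℂ (fun s => cfNuL A hA h2 (Gfam s)) 1) {ν₁ : ℝ}
    (hν₁ : cfNuL A hA h2 (Gfam 1) = ν₁) (α : ℝ) {E : ℂ → ℂ} (hE : ContinuousOn E {s : ℂ | 1 ≤ s.re})
    (x : Set.Icc (0 : ℝ) 1)
    (hLap : ∀ s : ℂ, 1 < s.re → ∫ u in Set.Ioi (0 : ℝ), (a u : ℂ) * Complex.exp (-s * u) =
      (α : ℂ) * cfResFun A hA (Gfam s) x ((cfDimension A : ℂ) * s) / s + E s) :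
    Tendsto (fun u => Real.exp (-u) * a u) atTop
      (𝓝 (α * ν₁ * cfHδ A hA h2 x / (cfDimension A * cfInt (cfNuδ A hA h2) (cfG A hA h2)))) := by
  have hδ := cfDimension_pos hA h2
  have hκ := cfInt_cfG_pos A hA h2
  have hδC : (cfDimension A : ℂ) ≠ 0 := Complex.ofReal_ne_zero.2 hδ.ne'
  have hκC : ((cfInt (cfNuδ A hA h2) (cfG A hA h2) : ℝ) : ℂ) ≠ 0 := Complex.ofReal_ne_zero.2 hκ.ne'
  set S : Set ℂ := {s : ℂ | 1 ≤ s.re} with hSdef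
  set c : ℝ := α * ν₁ * cfHδ A hA h2 x / (cfDimension A * cfInt (cfNuδ A hA h2) (cfG A hA h2)) with hcdef
  have hc : (c : ℂ) = (α : ℂ) * (ν₁ : ℂ) * (cfHδ A hA h2 x : ℂ) /
      ((cfDimension A : ℂ) * ((cfInt (cfNuδ A hA h2) (cfG A hA h2) : ℝ) : ℂ)) := by
    simp only [hcdef, Complex.ofReal_div, Complex.ofReal_mul]
  -- the pole of the resolvent near `δ`
  obtain ⟨ε, hε, Wreg, han, hinv⟩ := cfResolvent_pole' A hA h2
  set κC : ℂ := ((cfInt (cfNuδ A hA h2) (cfG A hA h2) : ℝ) : ℂ) with hκCdef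
  have hpole : ∀ s ∈ ball (cfDimension A : ℂ) ε, s ≠ (cfDimension A : ℂ) → ∀ G : CfLip,
      cfResFun A hA G x s = Wreg s G x + ((s - cfDimension A)⁻¹ * κC⁻¹) * (cfNuL A hA h2 G * (cfHδ A hA h2 x : ℂ)) := by
    intro s hs hne G
    obtain ⟨hl, hr⟩ := hinv s hs hne
    rw [cfResFun, (Ring.inverse_unit ⟨_, _, hl, hr⟩ : Ring.inverse (1 - cfLOp A hA s) = _)]
    show (Wreg s + ((s - cfDimension A)⁻¹ * κC⁻¹) • cfPi A hA h2) G x = _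
    rw [show ∀ (P Q : CfLip →L[ℂ] CfLip) (F : CfLip), (P + Q) F = P F + Q F from fun _ _ _ => rfl,
      show ∀ (c : ℂ) (P : CfLip →L[ℂ] CfLip) (F : CfLip), (c • P) F = c • P F from fun _ _ _ => rfl,
      cfPi_apply, smul_smul, CfLip.add_apply, CfLip.smul_apply, cfHL_apply, mul_assoc]
  -- the difference quotient of `s ↦ ν(G_s)` at `1`
  set nuf : ℂ → ℂ := fun s => cfNuL A hA h2 (Gfam s) with hnuf
  set D : ℂ → ℂ := dslope nuf 1 with hD
  have hDcont : ContinuousAt D 1 := continuousAt_dslope_same.2 hGdiff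
  have hnu : ∀ s, nuf s = ν₁ + (s - 1) * D s := fun s => by
    have h := sub_smul_dslope nuf 1 s
    rw [smul_eq_mul] at h
    rw [hD, h, hnuf]
    simp only [hν₁]
    ring
  -- the continued Laplace transform
  set hx : ℂ := (cfHδ A hA h2 x : ℂ) with hhx
  set Gs : ℂ → ℂ := fun s => if s = 1 then
      (α : ℂ) * Wreg (cfDimension A : ℂ) (Gfam 1) x + (α : ℂ) * hx * D 1 / ((cfDimension A : ℂ) * κC) - c + E 1
    else (α : ℂ) * cfResFun A hA (Gfam s) x ((cfDimension A : ℂ) * s) / s + E s - c / (s - 1) with hGs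
  -- `Gs` is the Laplace transform of `B - c`
  have hGeq : ∀ s : ℂ, 1 < s.re →
      Gs s = ∫ u in Set.Ioi (0 : ℝ), ((cfDens a u - c : ℝ) : ℂ) * Complex.exp (-(s - 1) * u) := by
    intro s hs
    have hs1 : s ≠ 1 := fun h => by rw [h, Complex.one_re] at hs; exact lt_irrefl _ hs
    simp only [hGs, if_neg hs1]
    have hI1 := integrableOn_cfDens_cexp hmono ha0 hK0 hK hs
    have hsm1 : (-(s - 1)).re < 0 := by simp; linarith
    have hI2 : IntegrableOn (fun u : ℝ => (c : ℂ) * Complex.exp (-(s - 1) * u)) (Set.Ioi 0) :=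
      (integrableOn_exp_mul_complex_Ioi hsm1 0).const_mul _
    have hsplit : ∀ u : ℝ, ((cfDens a u - c : ℝ) : ℂ) * Complex.exp (-(s - 1) * u) =
        ((cfDens a u : ℝ) : ℂ) * Complex.exp (-(s - 1) * u) - (c : ℂ) * Complex.exp (-(s - 1) * u) := by
      intro u; push_cast; ring
    simp_rw [hsplit]
    rw [integral_sub hI1 hI2, integral_const_mul_cexp c hs,
      setIntegral_congr_fun measurableSet_Ioi (fun u hu => cfDens_mul_cexp hu s), hLap s hs]
  -- continuity of `Gs` on `Re s ≥ 1`
  have hGcont' : ContinuousOn Gs S := by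
    intro s₀ hs₀
    have hs₀re : 1 ≤ s₀.re := hs₀
    have hs₀0 : s₀ ≠ 0 := fun h => by rw [h, Complex.zero_re] at hs₀re; linarith
    -- the building block `s ↦ (T(s) (Gfam s))(x)` for an operator family continuous within `S`
    have happly : ∀ {T : ℂ → CfLip →L[ℂ] CfLip} {s₁ : ℂ}, s₁ ∈ S → ContinuousWithinAt T S s₁ →
        ContinuousWithinAt (fun s => T s (Gfam s) x) S s₁ := by
      intro T s₁ hs₁ hT
      have h := hT.clm_apply (hGcont s₁ hs₁)
      exact (CfLip.eval x).continuous.continuousAt.comp_continuousWithinAt h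
    by_cases h1 : s₀ = 1
    · subst h1
      -- near `1`
      have hr : 0 < min (ε / cfDimension A) 1 := lt_min (div_pos hε hδ) one_pos
      set g₂ : ℂ → ℂ := fun s => (α : ℂ) * Wreg ((cfDimension A : ℂ) * s) (Gfam s) x / s +
        (α : ℂ) * hx * D s / ((cfDimension A : ℂ) * κC * s) - c / s + E s with hg₂
      have heq : ∀ s ∈ ball (1 : ℂ) (min (ε / cfDimension A) 1), Gs s = g₂ s := by
        intro s hs
        rw [Metric.mem_ball, lt_min_iff] at hs
        have hs0 : s ≠ 0 := by
          intro h0; rw [h0, dist_zero_left, norm_one] at hs; exact lt_irrefl _ hs.2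
        by_cases hs1 : s = 1
        · subst hs1
          simp only [hGs, hg₂, if_pos rfl, mul_one, div_one]
        · simp only [hGs, hg₂, if_neg hs1]
          have hball : (cfDimension A : ℂ) * s ∈ ball (cfDimension A : ℂ) ε := by
            rw [Metric.mem_ball, dist_eq_norm, show (cfDimension A : ℂ) * s - cfDimension A =
              (cfDimension A : ℂ) * (s - 1) by ring, norm_mul, Complex.norm_real, Real.norm_of_nonneg hδ.le]
            rw [dist_eq_norm] at hs
            calc cfDimension A * ‖s - 1‖ < cfDimension A * (ε / cfDimension A) :=
                  mul_lt_mul_of_pos_left hs.1 hδ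
              _ = ε := mul_div_cancel₀ _ hδ.ne'
          have hne : (cfDimension A : ℂ) * s ≠ (cfDimension A : ℂ) := by
            intro h
            apply hs1
            have : (cfDimension A : ℂ) * s = (cfDimension A : ℂ) * 1 := by rw [h, mul_one]
            exact mul_left_cancel₀ hδC this
          have hsub : (cfDimension A : ℂ) * s - cfDimension A ≠ 0 := sub_ne_zero.2 hne
          have hs1' : s - 1 ≠ 0 := sub_ne_zero.2 hs1
          rw [hpole _ hball hne, show cfNuL A hA h2 (Gfam s) = nuf s from rfl, hnu s, hc]
          field_simp
          ring
      have hg₂cont : ContinuousWithinAt g₂ S 1 := by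
        have hW : ContinuousWithinAt (fun s => Wreg ((cfDimension A : ℂ) * s) (Gfam s) x) S 1 := by
          refine happly (show (1 : ℂ) ∈ S from by simp [hSdef]) ?_
          have hWa : ContinuousAt Wreg ((cfDimension A : ℂ) * 1) := by
            rw [mul_one]; exact (han _ (mem_ball_self hε)).continuousAt
          exact (hWa.comp (continuous_const.mul continuous_id).continuousAt).continuousWithinAt
        have hDw : ContinuousWithinAt D S 1 := hDcont.continuousWithinAt
        have hEw : ContinuousWithinAt E S 1 := hE 1 (by simp [hSdef])
        have hid : ContinuousWithinAt (fun s : ℂ => s) S 1 := continuousWithinAt_id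
        have h1ne : ((cfDimension A : ℂ) * κC * 1) ≠ 0 := by rw [mul_one]; exact mul_ne_zero hδC hκC
        refine ((ContinuousWithinAt.add (ContinuousWithinAt.sub (ContinuousWithinAt.add ?_ ?_) ?_) hEw))
        · exact (continuousWithinAt_const.mul hW).div hid one_ne_zero
        · exact ((continuousWithinAt_const.mul continuousWithinAt_const).mul hDw).div
            ((continuousWithinAt_const.mul continuousWithinAt_const).mul hid) h1ne
        · exact continuousWithinAt_const.div hid one_ne_zero
      exact hg₂cont.congr_of_eventuallyEq
        (Filter.eventuallyEq_of_mem (mem_nhdsWithin_of_mem_nhds (Metric.ball_mem_nhds (1 : ℂ) hr)) heq)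
        (heq 1 (mem_ball_self hr))
    · -- away from `1`
      set g₁ : ℂ → ℂ := fun s => (α : ℂ) * cfResFun A hA (Gfam s) x ((cfDimension A : ℂ) * s) / s + E s - c / (s - 1)
        with hg₁
      have heq : ∀ᶠ s in 𝓝 s₀, Gs s = g₁ s := by
        filter_upwards [eventually_ne_nhds h1] with s hs
        simp only [hGs, hg₁, if_neg hs]
      have hre : cfDimension A ≤ ((cfDimension A : ℂ) * s₀).re := by
        rw [Complex.re_ofReal_mul]; nlinarith
      have hne : (cfDimension A : ℂ) * s₀ ≠ (cfDimension A : ℂ) := by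
        intro h
        apply h1
        have : (cfDimension A : ℂ) * s₀ = (cfDimension A : ℂ) * 1 := by rw [h, mul_one]
        exact mul_left_cancel₀ hδC this
      have hR : ContinuousWithinAt (fun s => Ring.inverse (1 - cfLOp A hA ((cfDimension A : ℂ) * s))) S s₀ :=
        ((continuousAt_inverse_one_sub_cfLOp A hA h2 hre hne).comp
          (continuous_const.mul continuous_id).continuousAt).continuousWithinAt
      have hF : ContinuousWithinAt (fun s => cfResFun A hA (Gfam s) x ((cfDimension A : ℂ) * s)) S s₀ :=
        happly hs₀ hR
      have hEw : ContinuousWithinAt E S s₀ := hE s₀ hs₀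
      have hid : ContinuousWithinAt (fun s : ℂ => s) S s₀ := continuousWithinAt_id
      have hg₁cont : ContinuousWithinAt g₁ S s₀ :=
        (((continuousWithinAt_const.mul hF).div hid hs₀0).add hEw).sub
          (continuousWithinAt_const.div (hid.sub continuousWithinAt_const) (sub_ne_zero.2 h1))
      exact hg₁cont.congr_of_eventuallyEq (heq.filter_mono nhdsWithin_le_nhds) heq.self_of_nhds
  have hlim := Literature.NumberTheory.LFunctions.WienerIkehara.tendsto_of_laplace c (measurable_cfDens hmono)
    (cfDens_nonneg ha0) (fun u hu => cfDens_of_nonpos a hu) (fun u v huv => cfDens_mono hmono ha0 u v huv)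
    (fun ε' hε' => integrableOn_cfDens hmono ha0 hK0 hK hε') hGcont' hGeq
  refine hlim.congr' ?_
  filter_upwards [eventually_gt_atTop 0] with u hu
  exact cfDens_of_pos a hu

omit hA h2 in
/-- Translation to the counting variable: if `e^{-u} N(e^{u/(2δ)}) → c` then `N(X) X^{-2δ} → c`.
[folklore] -/
theorem tendsto_rpow_of_tendsto_exp {N : ℝ → ℝ} {c : ℝ} (hδ : 0 < cfDimension A)
    (h : Tendsto (fun u => Real.exp (-u) * N (Real.exp (u / (2 * cfDimension A)))) atTop (𝓝 c)) :
    Tendsto (fun X : ℝ => N X / X ^ (2 * cfDimension A)) atTop (𝓝 c) := by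
  have hφ : Tendsto (fun X : ℝ => 2 * cfDimension A * Real.log X) atTop atTop :=
    Tendsto.const_mul_atTop (by positivity) Real.tendsto_log_atTop
  refine (h.comp hφ).congr' ?_
  filter_upwards [eventually_gt_atTop 1] with X hX
  have hX0 : 0 < X := by linarith
  show Real.exp (-(2 * cfDimension A * Real.log X)) * N (Real.exp (2 * cfDimension A * Real.log X / (2 * cfDimension A))) =
    N X / X ^ (2 * cfDimension A)
  have h1 : Real.exp (2 * cfDimension A * Real.log X / (2 * cfDimension A)) = X := by
    rw [mul_div_cancel_left₀ _ (by positivity : (2 * cfDimension A) ≠ 0), Real.exp_log hX0]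
  have h2' : Real.exp (-(2 * cfDimension A * Real.log X)) = (X ^ (2 * cfDimension A))⁻¹ := by
    rw [Real.rpow_def_of_pos hX0, ← Real.exp_neg]
    congr 1
    ring
  rw [h1, h2', inv_mul_eq_div]

end Tauber

end Literature.NumberTheory.Sieve
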